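import Summits.CriticalPhenomena.SAWScalingLimit.Theorems.SAWDevelopingMapHexConjectureReflexWedgeGeometry
import Literature.Probability.RandomPlanarGeometry.HexSAWHopfPath
import Literature.Probability.RandomPlanarGeometry.HexParafermionSpinShift

/-!
# Arc phases of the reflex wedge, part 1: swept angles, the cut ray and the lattice edges

Support file for the crux `HexConjecture` (stmt-CriticalPhenomena-0808, Duminil-Copin–Smirnov 2012 Conjecture 1),
line `marginal-reflex-wedge-cauchy-kernel`, stub `stub_arcPhases` (objects file
`SAWDevelopingMapHexConjectureMarginalWedgeDefs.lean`; coordinates from `…ReflexWedgeGeometryCoord.lean`): for every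
ARC dart `(v, w)` of the truncated `300°` wedge `W_N` (`v ∈ W_N`, `w ∉ W_N` adjacent, `N ≤ ‖c_w‖`) the dart direction
`c_w - c_v = e^{iθ}/√3` has a representative `θ ∈ [-11π/6, π/6]` such that every self-avoiding walk of `W_N` from
the corner mid-edge to `s(v, w)` has winding `θ + π/2`. The winding of an arbitrary such walk is evaluated by the
discrete Hopf Umlaufsatz for open lattice paths (`HV.hopf_path`, `HexSAWHopfPath.lean`): swept angle of the secant
into the end `w` plus swept angle of the secant from the start `o = c(cornerOut) = e^{iπ/6}/√3`.

This part supplies the two elementary tools for the sweeps and the lattice input of the start sweep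
(namespace `…MarginalWedge.ArcPhase`):
* `sum_toReal_argDiff_of_re_pos` — a sweep inside the open right half-plane is a difference of arguments;
* `toReal_argDiff_of_segment` — if the closed segment `[z₁, z₂]` misses `(-∞, 0]` then `|arg z₂ - arg z₁| < π`
  (a crossing of the real axis would have `sin (arg z₂ - arg z₁) ≤ 0`);
* the frame `ō · c` of the bisector: `re (ō c) = (3a+3b+2t+2)/6`, `im (ō c) = (b - a)√3/6` for the face
  `((a,b);t)` (`re_conj_cornerOut_mul_center`, `im_conj_cornerOut_mul_center`), `re_conj_mul_sub_pos`;
* **`arcPhase_segment_avoids_cut`** (registered helper) — a lattice edge between two faces off the cut (not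
  `((a,a);t)`, `a ≥ 0`) never meets the cut ray `{t·o : t ≥ 1}`: in the frame `ō(o - ·)` the closed segment misses
  `(-∞, 0]` (`im` is an integer multiple of `√3/6` changing by at most one along an edge).

Folklore plane geometry and lattice bookkeeping; no named fact is used.
-/

open scoped BigOperators Classical
open Literature.Probability.LatticeModels Literature.Probability.RandomPlanarGeometry
  Literature.Probability.RandomPlanarGeometry.SAW Literature.Probability.RandomPlanarGeometry.SAW.HV

namespace Summit.CriticalPhenomena.SAWScalingLimit.Theorems.HexConjecture.MarginalWedge.ArcPhase

open ReflexGeometry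

/-! ### Swept angles in the open right half-plane -/

/-- In the open right half-plane the angle between two vectors is the plain difference of their
arguments. [folklore] -/
theorem toReal_argDiff_of_re_pos {v w : ℂ} (hv : 0 < v.re) (hw : 0 < w.re) :
    ((Complex.arg v : Real.Angle) - (Complex.arg w : Real.Angle)).toReal = Complex.arg v - Complex.arg w := by
  have h1 := Complex.abs_arg_lt_pi_div_two_iff.2 (Or.inl hv)
  have h2 := Complex.abs_arg_lt_pi_div_two_iff.2 (Or.inl hw)
  rw [abs_lt] at h1 h2
  rw [← Real.Angle.coe_sub, Real.Angle.toReal_coe_eq_self_iff]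
  constructor <;> linarith

/-- **Swept angle in the open right half-plane**: for nonzero vectors `u₀, …, u_N` with positive real
parts the total swept angle `Σ ∡(u_m, u_{m+1})` is `arg u_N - arg u₀`. [folklore] -/
theorem sum_toReal_argDiff_of_re_pos (u : ℕ → ℂ) :
    ∀ N : ℕ, (∀ m ≤ N, 0 < (u m).re) →
      ∑ m ∈ Finset.range N, ((Complex.arg (u (m + 1)) : Real.Angle) - (Complex.arg (u m) : Real.Angle)).toReal =
        Complex.arg (u N) - Complex.arg (u 0)
  | 0, _ => by simp
  | N + 1, hu => by
    rw [Finset.sum_range_succ, sum_toReal_argDiff_of_re_pos u N (fun m hm => hu m (by omega)),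
      toReal_argDiff_of_re_pos (hu (N + 1) le_rfl) (hu N (by omega))]
    ring

/-! ### The angle subtended by a segment avoiding the cut `(-∞, 0]` -/

/-- If the closed segment `[z₁, z₂]` avoids the closed negative real axis, then `arg z₂ - arg z₁ < π`:
otherwise `z₁` lies in the open lower and `z₂` in the open upper half-plane with `sin (arg z₂ - arg z₁) ≤ 0`,
and the segment crosses the real axis at a point of `(-∞, 0]`. [folklore] -/
theorem arg_sub_arg_lt_pi_of_segment {z₁ z₂ : ℂ}
    (h : ∀ s : ℝ, 0 ≤ s → s ≤ 1 →
      0 < (((1 - s : ℝ) : ℂ) * z₁ + (s : ℂ) * z₂).re ∨ (((1 - s : ℝ) : ℂ) * z₁ + (s : ℂ) * z₂).im ≠ 0) :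
    Complex.arg z₂ - Complex.arg z₁ < Real.pi := by
  by_contra hge
  push Not at hge
  have hz₂ := h 1 zero_le_one le_rfl
  have hz₁ := h 0 le_rfl zero_le_one
  simp only [sub_self, Complex.ofReal_zero, zero_mul, zero_add, Complex.ofReal_one, one_mul, sub_zero,
    add_zero] at hz₁ hz₂
  have h1 := Complex.neg_pi_lt_arg z₁
  have h2 := Complex.arg_le_pi z₂
  have hne2 : Complex.arg z₂ ≠ Real.pi := by
    intro he
    rw [Complex.arg_eq_pi_iff] at he
    rcases hz₂ with h | h
    · linarith [he.1]
    · exact h he.2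
  have hlt2 : Complex.arg z₂ < Real.pi := lt_of_le_of_ne h2 hne2
  have hneg1 : Complex.arg z₁ < 0 := by linarith
  have him1 : z₁.im < 0 := Complex.arg_neg_iff.1 hneg1
  have him2 : 0 < z₂.im := by
    rcases lt_trichotomy z₂.im 0 with h | h | h
    · have := Complex.arg_neg_iff.2 h
      linarith
    · exfalso
      rcases le_or_gt 0 z₂.re with hr | hr
      · have := Complex.arg_eq_zero_iff.2 ⟨hr, h⟩
        linarith
      · exact hne2 (Complex.arg_eq_pi_iff.2 ⟨hr, h⟩)
    · exact h
  -- the crossing point with the real axis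
  have hden : 0 < z₂.im - z₁.im := by linarith
  set s : ℝ := -z₁.im / (z₂.im - z₁.im) with hs
  have hs0 : 0 ≤ s := div_nonneg (by linarith) hden.le
  have hs1 : s ≤ 1 := by
    rw [hs, div_le_one hden]
    linarith
  have hre_eq : (((1 - s : ℝ) : ℂ) * z₁ + (s : ℂ) * z₂).re =
      (z₂.im * z₁.re - z₁.im * z₂.re) / (z₂.im - z₁.im) := by
    simp only [Complex.add_re, Complex.mul_re, Complex.ofReal_re, Complex.ofReal_im, zero_mul, sub_zero]
    rw [hs]
    field_simp
    ring
  have him_eq : (((1 - s : ℝ) : ℂ) * z₁ + (s : ℂ) * z₂).im = 0 := by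
    simp only [Complex.add_im, Complex.mul_im, Complex.ofReal_re, Complex.ofReal_im, zero_mul, add_zero]
    rw [hs]
    field_simp
    ring
  have hre : 0 < z₂.im * z₁.re - z₁.im * z₂.re := by
    rcases h s hs0 hs1 with h | h
    · rw [hre_eq] at h
      exact (div_pos_iff_of_pos_right hden).1 h
    · exact absurd him_eq h
  -- in polar form this is `‖z₁‖ ‖z₂‖ sin (arg z₂ - arg z₁) ≤ 0`
  have key : z₂.im * z₁.re - z₁.im * z₂.re =
      ‖z₁‖ * ‖z₂‖ * Real.sin (Complex.arg z₂ - Complex.arg z₁) := by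
    rw [Real.sin_sub, ← Complex.norm_mul_cos_arg z₁, ← Complex.norm_mul_sin_arg z₁,
      ← Complex.norm_mul_cos_arg z₂, ← Complex.norm_mul_sin_arg z₂]
    ring
  have hsin : Real.sin (Complex.arg z₂ - Complex.arg z₁) ≤ 0 := by
    have h3 : Real.sin (Complex.arg z₂ - Complex.arg z₁ - Real.pi) ≥ 0 :=
      Real.sin_nonneg_of_nonneg_of_le_pi (by linarith) (by linarith)
    rw [Real.sin_sub_pi] at h3
    linarith
  have : ‖z₁‖ * ‖z₂‖ * Real.sin (Complex.arg z₂ - Complex.arg z₁) ≤ 0 :=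
    mul_nonpos_of_nonneg_of_nonpos (by positivity) hsin
  linarith

/-- If the closed segment `[z₁, z₂]` avoids the closed negative real axis, the angle from `z₁` to `z₂`
is the plain difference of the arguments. [folklore] -/
theorem toReal_argDiff_of_segment {z₁ z₂ : ℂ}
    (h : ∀ s : ℝ, 0 ≤ s → s ≤ 1 →
      0 < (((1 - s : ℝ) : ℂ) * z₁ + (s : ℂ) * z₂).re ∨ (((1 - s : ℝ) : ℂ) * z₁ + (s : ℂ) * z₂).im ≠ 0) :
    ((Complex.arg z₂ : Real.Angle) - (Complex.arg z₁ : Real.Angle)).toReal = Complex.arg z₂ - Complex.arg z₁ := by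
  have h₁ := arg_sub_arg_lt_pi_of_segment h
  have h₂ : Complex.arg z₁ - Complex.arg z₂ < Real.pi := by
    refine arg_sub_arg_lt_pi_of_segment fun s hs0 hs1 => ?_
    have := h (1 - s) (by linarith) (by linarith)
    have e : (((1 - (1 - s) : ℝ) : ℂ) * z₂ + ((1 - s : ℝ) : ℂ) * z₁) =
        ((1 - s : ℝ) : ℂ) * z₁ + (s : ℂ) * z₂ := by
      push_cast
      ring
    -- careful: the statement for `(z₂, z₁)` uses `(1 - s) * z₂ + s * z₁`
    have e' : (((1 - s : ℝ) : ℂ) * z₂ + (s : ℂ) * z₁) =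
        ((1 - (1 - s) : ℝ) : ℂ) * z₁ + ((1 - s : ℝ) : ℂ) * z₂ := by
      push_cast
      ring
    rw [e']
    exact this
  rw [← Real.Angle.coe_sub, Real.Angle.toReal_coe_eq_self_iff]
  constructor <;> linarith

/-! ### The outer root vertex `cornerOut` (centre `o = 1/2 + i√3/6 = e^{iπ/6}/√3`) -/

/-- `o = (1/√3) e^{iπ/6}`. [folklore] -/
theorem cornerOut_eq_polar : hexCenter cornerOut =
    (((Real.sqrt 3)⁻¹ : ℝ) : ℂ) * (Complex.cos ((Real.pi / 6 : ℝ) : ℂ) + Complex.sin ((Real.pi / 6 : ℝ) : ℂ) * Complex.I) := by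
  have h3 : Real.sqrt 3 ^ 2 = 3 := Real.sq_sqrt (by norm_num)
  have hs : Real.sqrt 3 ≠ 0 := by positivity
  rw [← Complex.ofReal_cos, ← Complex.ofReal_sin, Real.cos_pi_div_six, Real.sin_pi_div_six]
  apply Complex.ext
  · rw [FluxLine.re_cornerOut]
    simp
    field_simp
    rw [h3]
  · rw [FluxLine.im_cornerOut]
    simp
    field_simp
    norm_num

/-- `arg o = π/6`. [folklore] -/
theorem arg_cornerOut : Complex.arg (hexCenter cornerOut) = Real.pi / 6 := by
  rw [cornerOut_eq_polar]
  exact Complex.arg_mul_cos_add_sin_mul_I (by positivity) ⟨by linarith [Real.pi_pos], by linarith [Real.pi_pos]⟩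

/-- `‖o‖² = 1/3`. [folklore] -/
theorem normSq_cornerOut : Complex.normSq (hexCenter cornerOut) = 1 / 3 := by
  have h3 : Real.sqrt 3 * Real.sqrt 3 = 3 := Real.mul_self_sqrt (by norm_num)
  rw [Complex.normSq_apply, FluxLine.re_cornerOut, FluxLine.im_cornerOut]
  nlinarith [h3]

/-- `‖o‖ < 1`. [folklore] -/
theorem norm_cornerOut_lt_one : ‖hexCenter cornerOut‖ < 1 := by
  rw [← abs_norm, ← sq_lt_one_iff_abs_lt_one, ← Complex.normSq_eq_norm_sq, normSq_cornerOut]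
  norm_num

/-- `o ≠ 0`. [folklore] -/
theorem cornerOut_ne_zero : hexCenter cornerOut ≠ 0 := by
  intro h
  have := normSq_cornerOut
  rw [h, map_zero] at this
  norm_num at this

/-! ### The rotated frame `conj(o) · z`: the bisector becomes the positive real axis -/

/-- `re (ō c_v) = (3a + 3b + 2t + 2)/6` for the face `((a,b);t)`. [folklore] -/
theorem re_conj_cornerOut_mul_center (a b : ℤ) (t : Fin 2) :
    ((starRingEnd ℂ) (hexCenter cornerOut) * hexCenter (((![a, b] : Site 2), t) : HexVertex)).re =
      (3 * a + 3 * b + 2 * ((t : ℕ) : ℝ) + 2) / 6 := by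
  have h3 : Real.sqrt 3 * Real.sqrt 3 = 3 := Real.mul_self_sqrt (by norm_num)
  have hre := two_mul_re_center a b t
  rw [Complex.mul_re, Complex.conj_re, Complex.conj_im, FluxLine.re_cornerOut, FluxLine.im_cornerOut, im_center_eq]
  linear_combination (1 / 4 : ℝ) * hre + ((3 * (b : ℝ) + ((t : ℕ) : ℝ) + 1) / 36) * h3

/-- `im (ō c_v) = (b - a) √3/6` for the face `((a,b);t)`. [folklore] -/
theorem im_conj_cornerOut_mul_center (a b : ℤ) (t : Fin 2) :
    ((starRingEnd ℂ) (hexCenter cornerOut) * hexCenter (((![a, b] : Site 2), t) : HexVertex)).im =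
      ((b : ℝ) - a) * (Real.sqrt 3 / 6) := by
  have hre := two_mul_re_center a b t
  rw [Complex.mul_im, Complex.conj_re, Complex.conj_im, FluxLine.re_cornerOut, FluxLine.im_cornerOut, im_center_eq]
  linear_combination (-(Real.sqrt 3 / 12)) * hre

/-! ### Vectors pointing out of a disc -/

/-- If `‖u‖ < ‖p‖` then `re (p̄ (p - u)) > 0`: seen from a point `p`, every point of the open disc of
radius `‖p‖` lies in the open half-plane behind the tangent. [folklore] -/
theorem re_conj_mul_sub_pos {p u : ℂ} (h : ‖u‖ < ‖p‖) : 0 < ((starRingEnd ℂ) p * (p - u)).re := by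
  have hp : 0 < ‖p‖ := lt_of_le_of_lt (norm_nonneg u) h
  rw [mul_sub, Complex.sub_re, Complex.conj_mul', ← Complex.ofReal_pow, Complex.ofReal_re]
  have h1 : ((starRingEnd ℂ) p * u).re ≤ ‖p‖ * ‖u‖ := by
    calc ((starRingEnd ℂ) p * u).re ≤ ‖(starRingEnd ℂ) p * u‖ := Complex.re_le_norm _
      _ = ‖p‖ * ‖u‖ := by rw [norm_mul, Complex.norm_conj]
  nlinarith [mul_lt_mul_of_pos_left h hp]

/-! ### Lattice edges avoid the cut ray `{t·o : t ≥ 1}` (the bisector beyond `o`) -/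

/-- `ō · o = 1/3`. [folklore] -/
theorem conj_cornerOut_mul_self : (starRingEnd ℂ) (hexCenter cornerOut) * hexCenter cornerOut = ((1 / 3 : ℝ) : ℂ) := by
  rw [← Complex.normSq_eq_conj_mul_self, normSq_cornerOut]

/-- The rotated frame along a segment: real part. [folklore] -/
theorem re_conj_cornerOut_mul_sub_comb (s : ℝ) (x y : ℂ) :
    ((starRingEnd ℂ) (hexCenter cornerOut) * (hexCenter cornerOut - (((1 - s : ℝ) : ℂ) * x + (s : ℂ) * y))).re =
      1 / 3 - (1 - s) * ((starRingEnd ℂ) (hexCenter cornerOut) * x).re - s * ((starRingEnd ℂ) (hexCenter cornerOut) * y).re := by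
  rw [mul_sub, conj_cornerOut_mul_self, mul_add, Complex.sub_re, Complex.add_re, Complex.ofReal_re,
    show (starRingEnd ℂ) (hexCenter cornerOut) * (((1 - s : ℝ) : ℂ) * x) = ((1 - s : ℝ) : ℂ) * ((starRingEnd ℂ) (hexCenter cornerOut) * x) by ring,
    show (starRingEnd ℂ) (hexCenter cornerOut) * ((s : ℂ) * y) = (s : ℂ) * ((starRingEnd ℂ) (hexCenter cornerOut) * y) by ring,
    Complex.re_ofReal_mul, Complex.re_ofReal_mul]
  ring

/-- The rotated frame along a segment: imaginary part. [folklore] -/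
theorem im_conj_cornerOut_mul_sub_comb (s : ℝ) (x y : ℂ) :
    ((starRingEnd ℂ) (hexCenter cornerOut) * (hexCenter cornerOut - (((1 - s : ℝ) : ℂ) * x + (s : ℂ) * y))).im =
      -((1 - s) * ((starRingEnd ℂ) (hexCenter cornerOut) * x).im + s * ((starRingEnd ℂ) (hexCenter cornerOut) * y).im) := by
  rw [mul_sub, conj_cornerOut_mul_self, mul_add, Complex.sub_im, Complex.add_im, Complex.ofReal_im,
    show (starRingEnd ℂ) (hexCenter cornerOut) * (((1 - s : ℝ) : ℂ) * x) = ((1 - s : ℝ) : ℂ) * ((starRingEnd ℂ) (hexCenter cornerOut) * x) by ring,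
    show (starRingEnd ℂ) (hexCenter cornerOut) * ((s : ℂ) * y) = (s : ℂ) * ((starRingEnd ℂ) (hexCenter cornerOut) * y) by ring,
    Complex.im_ofReal_mul, Complex.im_ofReal_mul]
  ring

/-- **A lattice edge from an up-face avoids the cut ray** `{t·o : t ≥ 1}` as soon as neither endpoint is a
face `((a,a);t)` with `a ≥ 0` (the only faces on that ray): in the frame `ō·(o - ·)` no point of the
closed segment lies on `(-∞, 0]`. In coordinates `im (ō c) = (b - a)√3/6` is an integer multiple of
`√3/6` changing by at most one along an edge, and `re (ō c) = (3a+3b+2t+2)/6`. [folklore] -/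
theorem segment_avoids_cut_up (a b : ℤ) (g : HexVertex)
    (hadj : hexGraph.Adj (((![a, b] : Site 2), (0 : Fin 2)) : HexVertex) g)
    (hf : a ≠ b ∨ a < 0) (hg : g.1 0 ≠ g.1 1 ∨ g.1 0 < 0) (s : ℝ) (hs0 : 0 ≤ s) (hs1 : s ≤ 1) :
    0 < ((starRingEnd ℂ) (hexCenter cornerOut) * (hexCenter cornerOut -
        (((1 - s : ℝ) : ℂ) * hexCenter (((![a, b] : Site 2), (0 : Fin 2)) : HexVertex) + (s : ℂ) * hexCenter g))).re ∨
      ((starRingEnd ℂ) (hexCenter cornerOut) * (hexCenter cornerOut -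
        (((1 - s : ℝ) : ℂ) * hexCenter (((![a, b] : Site 2), (0 : Fin 2)) : HexVertex) + (s : ℂ) * hexCenter g))).im ≠ 0 := by
  obtain ⟨y, t'⟩ := g
  obtain ⟨a', b', rfl⟩ : ∃ a' b' : ℤ, y = ![a', b'] := ⟨y 0, y 1, by funext j; fin_cases j <;> rfl⟩
  simp only [Matrix.cons_val_zero, Matrix.cons_val_one, Matrix.cons_val_fin_one] at hg
  rw [hexGraph_adj_iff_coord] at hadj
  simp only [Matrix.cons_val_zero, Matrix.cons_val_one, Matrix.cons_val_fin_one, true_and, zero_ne_one,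
    false_and, or_false] at hadj
  obtain ⟨rfl, hc⟩ := hadj
  rw [re_conj_cornerOut_mul_sub_comb, im_conj_cornerOut_mul_sub_comb, re_conj_cornerOut_mul_center,
    re_conj_cornerOut_mul_center, im_conj_cornerOut_mul_center, im_conj_cornerOut_mul_center]
  simp only [Fin.val_zero, Fin.val_one, Nat.cast_zero, Nat.cast_one, mul_zero, add_zero, mul_one]
  by_contra hcon
  push Not at hcon
  obtain ⟨hre, him⟩ := hcon
  have hs3 : (0 : ℝ) < Real.sqrt 3 / 6 := by positivity
  have him' : (1 - s) * ((b : ℝ) - a) + s * ((b' : ℝ) - a') = 0 := by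
    have : ((1 - s) * ((b : ℝ) - a) + s * ((b' : ℝ) - a')) * (Real.sqrt 3 / 6) = 0 := by linarith
    exact (mul_eq_zero.1 this).resolve_right hs3.ne'
  rcases hc with ⟨h1, h2⟩ | ⟨h1, h2⟩ | ⟨h1, h2⟩ <;> subst a' b' <;> push_cast at him' hre hg
  · -- the edge inside the cell `(a, b)`, parallel to the bisector
    have hab' : (a : ℝ) = b := by linarith
    have hab : a = b := by exact_mod_cast hab'
    have ha : a < 0 := hf.resolve_left (fun h => h hab)
    have ha' : (a : ℝ) ≤ -1 := by exact_mod_cast (show a ≤ -1 by omega)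
    rw [← hab'] at hre
    nlinarith
  · -- the edge to the cell `(a - 1, b)`: `(b - a) + s = 0`
    have hL : ((b : ℝ) - a) = -s := by linarith
    have hL1 : -1 ≤ b - a := by exact_mod_cast (show (-1 : ℝ) ≤ (b : ℝ) - a by linarith)
    have hL2 : b - a ≤ 0 := by exact_mod_cast (show ((b : ℝ) - a) ≤ 0 by linarith)
    rcases (show b = a ∨ b = a - 1 by omega) with hb | hb <;> subst b
    · have hs : s = 0 := by linarith
      subst hs
      have ha : a < 0 := hf.resolve_left (fun h => h rfl)
      have ha' : (a : ℝ) ≤ -1 := by exact_mod_cast (show a ≤ -1 by omega)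
      nlinarith
    · have hs : s = 1 := by push_cast at hL; linarith
      subst hs
      have ha : a - 1 < 0 := hg.resolve_left (fun h => h rfl)
      have ha' : (a : ℝ) ≤ 0 := by exact_mod_cast (show a ≤ 0 by omega)
      push_cast at hre
      nlinarith
  · -- the edge to the cell `(a, b - 1)`: `(b - a) - s = 0`
    have hL : ((b : ℝ) - a) = s := by linarith
    have hL1 : 0 ≤ b - a := by exact_mod_cast (show (0 : ℝ) ≤ (b : ℝ) - a by linarith)
    have hL2 : b - a ≤ 1 := by exact_mod_cast (show ((b : ℝ) - a) ≤ 1 by linarith)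
    rcases (show b = a ∨ b = a + 1 by omega) with hb | hb <;> subst b
    · have hs : s = 0 := by linarith
      subst hs
      have ha : a < 0 := hf.resolve_left (fun h => h rfl)
      have ha' : (a : ℝ) ≤ -1 := by exact_mod_cast (show a ≤ -1 by omega)
      nlinarith
    · have hs : s = 1 := by push_cast at hL; linarith
      subst hs
      have ha : a < 0 := hg.resolve_left (fun h => h (by ring))
      have ha' : (a : ℝ) ≤ -1 := by exact_mod_cast (show a ≤ -1 by omega)
      push_cast at hre
      nlinarith

/-- **A lattice edge off the cut avoids the cut ray** (either orientation): for adjacent faces `f`, `g`, neither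
of the form `((a,a);t)` with `a ≥ 0`, no point of the closed segment `[c_f, c_g]` is mapped by `ō(o - ·)` to the
closed negative real axis. Registered helper `arcPhase_segment_avoids_cut` of the stub `stub_arcPhases`. [folklore] -/
theorem arcPhase_segment_avoids_cut : ∀ {f g : HexVertex}, hexGraph.Adj f g → (f.1 0 ≠ f.1 1 ∨ f.1 0 < 0) → (g.1 0 ≠ g.1 1 ∨ g.1 0 < 0) → ∀ (s : ℝ), 0 ≤ s → s ≤ 1 → 0 < ((starRingEnd ℂ) (hexCenter cornerOut) * (hexCenter cornerOut - (((1 - s : ℝ) : ℂ) * hexCenter f + (s : ℂ) * hexCenter g))).re ∨ ((starRingEnd ℂ) (hexCenter cornerOut) * (hexCenter cornerOut - (((1 - s : ℝ) : ℂ) * hexCenter f + (s : ℂ) * hexCenter g))).im ≠ 0 := by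
  intro f g hadj hf hg s hs0 hs1
  obtain ⟨x, t⟩ := f
  obtain ⟨a, b, rfl⟩ : ∃ a b : ℤ, x = ![a, b] := ⟨x 0, x 1, by funext j; fin_cases j <;> rfl⟩
  simp only [Matrix.cons_val_zero, Matrix.cons_val_one, Matrix.cons_val_fin_one] at hf
  obtain ⟨y, t'⟩ := g
  obtain ⟨a', b', rfl⟩ : ∃ a' b' : ℤ, y = ![a', b'] := ⟨y 0, y 1, by funext j; fin_cases j <;> rfl⟩
  have hadj' := hadj
  rw [hexGraph_adj_iff_coord] at hadj'
  rcases hadj' with ⟨rfl, rfl, -⟩ | ⟨rfl, rfl, -⟩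
  · exact segment_avoids_cut_up a b _ hadj hf hg s hs0 hs1
  · simp only [Matrix.cons_val_zero, Matrix.cons_val_one, Matrix.cons_val_fin_one] at hg
    have key := segment_avoids_cut_up a' b' _ hadj.symm hg (by simpa using hf) (1 - s) (by linarith) (by linarith)
    have e : ((1 - (1 - s) : ℝ) : ℂ) * hexCenter (((![a', b'] : Site 2), (0 : Fin 2)) : HexVertex) +
        ((1 - s : ℝ) : ℂ) * hexCenter (((![a, b] : Site 2), (1 : Fin 2)) : HexVertex) =
        ((1 - s : ℝ) : ℂ) * hexCenter (((![a, b] : Site 2), (1 : Fin 2)) : HexVertex) +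
          (s : ℂ) * hexCenter (((![a', b'] : Site 2), (0 : Fin 2)) : HexVertex) := by
      push_cast
      ring
    rw [e] at key
    exact key

end Summit.CriticalPhenomena.SAWScalingLimit.Theorems.HexConjecture.MarginalWedge.ArcPhase
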